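import Literature.Geometry.Symplectic.AlmostComplexTangentBundleIso
import Literature.Geometry.Symplectic.AlmostComplexChernNumberLocalization
import Literature.AlgebraicTopology.CharacteristicClasses.CompletionThomClassSteenrod
import Literature.Geometry.Riemannian.DiagonalTubularNeighbourhood
import Literature.Geometry.Riemannian.RiemannianMetricExists
import Literature.Geometry.Lorentzian.LeviCivitaProofs
import Literature.AlgebraicTopology.SingularHomology.RelativeCochainsExcision
import Literature.AlgebraicTopology.SingularHomology.FundamentalClassProofs
import Literature.AlgebraicTopology.SingularHomology.UniversalCoefficientsField
import HarnessLib

/-!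
# The mod-2 diagonal class of an almost complex `4`-manifold and `Sq² u'' = u'' ⌣ (c̄₁ × 1)`

J. Milnor, J. Stasheff, *Characteristic Classes* (1974), §11 (pp. 121–127): for a closed manifold
`M` the diagonal `Δ ⊂ M × M` has normal bundle `TM`; a tubular neighbourhood `N ≅ TM` of `Δ`
(Thm. 11.1 / Cor. 11.6) and excision carry the Thom class of `TM` to the **diagonal class**
`u' ∈ Hⁿ(M × M, M × M ∖ Δ)`, with image `u'' ∈ Hⁿ(M × M)`; Lemma 11.8: `(a × 1) ⌣ u' = (1 × a) ⌣ u'`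
(the two projections agree on `Δ`, onto which `N` retracts); and (proof of Thm. 11.14, Wu's
formula) `Sqᵏ u' = (wₖ × 1) ⌣ u'` by Thom's identity.

This file carries this out MOD 2, in dimension `4`, for the tangent bundle of an almost complex
`4`-manifold `(M, J)` read as the complex vector bundle `(TM, J)` (`complexTangentBundle`,
`tangentHomeomorph`), with the tree's completion model of the Thom class
(`relComplThomClass` on `(D, D ∖ s₀)`, `D = P(TM ⊕ ℂ)`), the tubular neighbourhood of the diagonal
given by the exponential map (`Riemannian.exists_expPair_openPartialHomeomorph`) and excision
(`relSingularCohomology.isIso_map_subsetIncl_of_interior`):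

* `tangentComplMap` — `Φ : TM → D`, `v ↦ [v : 1]`, a map of pairs `(TM, TM ∖ 0) → (D, D ∖ s₀)` over `M`;
  `tau` — `τ = Φ^* t̃ ∈ H⁴(TM, TM ∖ 0; ℤ/2)`, and **`relSteenrodSq_two_tau`: `Sq² τ = τ ⌣ π^* c̄₁`**
  (`c̄₁ = c₁(TM, J) mod 2`, from `relSteenrodSq_two_relComplThomClass`);
* for an open partial homeomorphism `e : TM ⇀ M × M` of the form `v ↦ (π v, ex v)` with `ex ≃ π`,
  zero section inside the source and `ex v = π v ↔ v = 0` there (the exponential tube):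
  `tubeInverse`, `tubeClass` (`u'` read on the tube `N = e.target`), **`diagRelClass`**
  (`u' ∈ H⁴(M × M, M × M ∖ Δ; ℤ/2)`, through the excision isomorphism) and **`diagClass`** (`u''`);
* **`relSteenrodSq_two_diagRelClass`, `steenrodSq_two_diagClass`** — `Sq² u' = u' ⌣ (c̄₁ × 1)`,
  `Sq² u'' = u'' ⌣ (c̄₁ × 1)` (Milnor–Stasheff p. 132 with `w₂ ≡ c₁`);
* **`cupRight_diagRelClass_fst_eq_snd`, `diagClass_cup_fst_eq_snd`** — Lemma 11.8,
  `u' ⌣ (a × 1) = u' ⌣ (1 × a)`;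
* `exists_expTube` — the exponential tube of a Riemannian metric has all the properties assumed.

No named facts; the definitions are constructions (D-0026).  Written for Wu's formula
`c₁(TM, J) ≡ v₂(M)` (`firstChernClass_modTwo_eq_wuClass_almostComplex_four`).

## References

* J. Milnor, J. Stasheff, *Characteristic Classes*, Ann. of Math. Stud. 76 (1974), §11
  (Thm. 11.1, Cor. 11.6, Lemma 11.8, proof of Thm. 11.14). [MilnorStasheff1974]
* A. Hatcher, *Algebraic Topology*, CUP 2002, §3.1 p. 201 (excision), §4.L. [HatcherAT2002]
-/

noncomputable section

open CategoryTheory Function Set Bundle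
open Literature.AlgebraicTopology.SingularHomology Literature.AlgebraicTopology.CharacteristicClasses
open Literature.AlgebraicTopology.CharacteristicClasses.ComplexVectorBundle
open scoped Manifold ContDiff Topology

namespace Literature.Geometry.Symplectic

namespace AlmostComplexStructure

variable {M : Type} [TopologicalSpace M] [T2Space M] [CompactSpace M]
  [ChartedSpace (EuclideanSpace ℝ (Fin 4)) M] [IsManifold (𝓡 4) ∞ M]
  (J : AlmostComplexStructure (𝓡 4) ∞ M)

/-! ### Ranks -/

omit [T2Space M] [CompactSpace M] in
/-- `rank (TM, J) = 2` in dimension `4`. [folklore] -/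
theorem rank_complexTangentBundle_four : J.complexTangentBundle.rank = 2 := by
  rw [J.rank_complexTangentBundle, finrank_euclideanSpace_four_div_two]

omit [T2Space M] [CompactSpace M] in
/-- `0 < rank (TM, J)`. [folklore] -/
theorem rank_complexTangentBundle_four_pos : 0 < J.complexTangentBundle.rank := by
  rw [J.rank_complexTangentBundle_four]; exact two_pos

omit [T2Space M] [CompactSpace M] in
/-- `2 · rank (TM, J) = 4`. [folklore] -/
theorem two_mul_rank_complexTangentBundle_four : 2 * J.complexTangentBundle.rank = 4 := by
  rw [J.rank_complexTangentBundle_four]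

omit [IsManifold (𝓡 4) ∞ M] in
/-- `H⁶(M; ℤ/2) = 0` for a closed `4`-manifold. [cite: HatcherAT2002, §3.3 Thm. 3.26 (c)] -/
theorem singularCohomology_six_eq_zero (z : singularCohomology (ZMod 2) (ZMod 2) M 6) : z = 0 := by
  haveI : Fact (Nat.Prime 2) := ⟨Nat.prime_two⟩
  haveI : Subsingleton (singularHomology (ZMod 2) (ZMod 2) M 6) :=
    ModuleCat.subsingleton_of_isZero
      (isZero_singularHomology_of_lt_holds (R := ZMod 2) (M := ZMod 2) (X := M) 4 (by norm_num))
  haveI : Subsingleton (singularHomology (ZMod 2) (ZMod 2) M 6 →ₗ[ZMod 2] ZMod 2) := inferInstance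
  haveI := (kroneckerPairing_bijective_of_field (ZMod 2) M 6).1.subsingleton
  exact Subsingleton.elim _ _

/-! ### `Φ : (TM, TM ∖ 0) → (D, D ∖ s₀)` and `τ = Φ^* t̃` -/

/-- The bundle projection `π : TM → M` as a continuous map. [folklore] -/
abbrev tangentProj : C(TangentBundle (𝓡 4) M, M) :=
  ⟨TotalSpace.proj, FiberBundle.continuous_proj (EuclideanSpace ℝ (Fin 4)) (TangentSpace (𝓡 4) : M → Type _)⟩

/-- **`Φ : TM → D = P(TM ⊕ ℂ)`, `v ↦ [v : 1]`**: the identification `TM ≅ (TM, J)` (`tangentHomeomorph`)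
followed by the open embedding of the vector bundle into its projective completion (`complEmbed`).
[cite: MilnorStasheff1974, §11 p. 122] -/
def tangentComplMap : C(TangentBundle (𝓡 4) M, J.complexTangentBundle.compl.Proj) :=
  (⟨complEmbed J.complexTangentBundle.F J.complexTangentBundle.E,
      continuous_complEmbed J.complexTangentBundle.F J.complexTangentBundle.E⟩ :
      C(TotalSpace J.complexTangentBundle.F J.complexTangentBundle.E, J.complexTangentBundle.compl.Proj)).comp
    (J.tangentHomeomorph.symm : C(TangentBundle (𝓡 4) M, J.complexTangentCore.TotalSpace))

omit [T2Space M] [CompactSpace M] in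
/-- `Φ` covers the identity: `q̂ ∘ Φ = π`. [folklore] -/
theorem projMap_comp_tangentComplMap :
    J.complexTangentBundle.compl.projMap.comp J.tangentComplMap = tangentProj :=
  ContinuousMap.ext fun _ ↦ by rfl

omit [T2Space M] [CompactSpace M] in
/-- `Φ v` on the fibre coordinate: `(Φ v)` is `[β_x⁻¹ v : 1]`. [folklore] -/
theorem tangentComplMap_apply (v : TangentBundle (𝓡 4) M) :
    J.tangentComplMap v = complEmbed J.complexTangentBundle.F J.complexTangentBundle.E
      ⟨v.proj, (J.complexTangentCore_fiberEquiv v.proj).symm v.snd⟩ := by rfl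

omit [T2Space M] [CompactSpace M] in
/-- **`Φ` is a map of pairs `(TM, TM ∖ 0) → (D, D ∖ s₀(M))`.** [cite: MilnorStasheff1974, §11 p. 122] -/
theorem mapsTo_tangentComplMap :
    MapsTo J.tangentComplMap {v : TangentBundle (𝓡 4) M | v.snd ≠ 0}
      (vectorPart J.complexTangentBundle.F J.complexTangentBundle.E) := by
  intro v hv
  rw [J.tangentComplMap_apply]
  refine (complEmbed_mem_vectorPart_iff _ _ _).2 fun h ↦ hv ?_
  exact (J.complexTangentCore_fiberEquiv v.proj).symm.map_eq_zero_iff.1 h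

/-- **`τ = Φ^* t̃ ∈ H⁴(TM, TM ∖ 0; ℤ/2)`**: the mod-2 Thom class of `TM` read from the completion model
(`relComplThomClass`, transported to degree `4 = 2 · rank`). [cite: MilnorStasheff1974, §11 p. 122] -/
def tau : relSingularCohomology (ZMod 2) (ZMod 2) (TangentBundle (𝓡 4) M) {v | v.snd ≠ 0} 4 :=
  relSingularCohomology.map (ZMod 2) (ZMod 2) J.tangentComplMap J.mapsTo_tangentComplMap 4
    (ComplexVectorBundle.relDegCast (ZMod 2) J.two_mul_rank_complexTangentBundle_four
      (J.complexTangentBundle.relComplThomClass (ZMod 2) J.rank_complexTangentBundle_four_pos))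

/-- **`c̄₁ = c₁(TM, J) mod 2 ∈ H²(M; ℤ/2)`** (the Grothendieck Chern class with `ℤ/2` coefficients, which
is the reduction of the integral one, `chernClassR_modTwo`). [cite: MilnorStasheff1974, §14 Problem 14-B] -/
def cbarOne : singularCohomology (ZMod 2) (ZMod 2) M 2 := J.complexTangentBundle.chernClassR (ZMod 2) 1

/-- **Thom: `Sq² τ = τ ⌣ π^* c̄₁` in `H⁶(TM, TM ∖ 0; ℤ/2)`** (`relSteenrodSq_two_relComplThomClass` pulled
back along `Φ`). [cite: MilnorStasheff1974, §8 Thm. 8.1 and §14 Problem 14-B] -/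
theorem relSteenrodSq_two_tau :
    relSteenrodSqLower (TangentBundle (𝓡 4) M) 4 {v : TangentBundle (𝓡 4) M | v.snd ≠ 0} 6 2 J.tau =
      relSingularCohomology.cupRight (p := 4) (q := 2) (n := 6) rfl J.tau
        (singularCohomology.map (ZMod 2) (ZMod 2) (tangentProj : C(TangentBundle (𝓡 4) M, M)) 2 J.cbarOne) := by
  rw [tau, ← relSteenrodSqLower_map,
    J.complexTangentBundle.relSteenrodSq_two_relComplThomClass J.rank_complexTangentBundle_four_pos
      J.rank_complexTangentBundle_four J.two_mul_rank_complexTangentBundle_four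
      singularCohomology_six_eq_zero,
    relSingularCohomology.map_cupRight, ← J.projMap_comp_tangentComplMap, singularCohomology.map_comp,
    ModuleCat.comp_apply]
  rfl

/-! ### The diagonal class through a tube `e : TM ⇀ M × M` -/

section Tube

variable (ex : C(TangentBundle (𝓡 4) M, M)) (e : OpenPartialHomeomorph (TangentBundle (𝓡 4) M) (M × M))
  (he : ∀ v, e v = (v.proj, ex v)) (hez : ∀ v ∈ e.source, ex v = v.proj ↔ v.snd = 0)

/-- **`Ψ = e⁻¹ : N → TM`** on the tube `N = e.target`, as a continuous map. [cite: MilnorStasheff1974, §11 Thm. 11.1] -/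
def tubeInverse : C(↥e.target, TangentBundle (𝓡 4) M) :=
  ⟨e.target.restrict e.symm, continuousOn_iff_continuous_restrict.1 e.continuousOn_symm⟩

omit [T2Space M] [CompactSpace M] in
include he in
/-- `π ∘ Ψ = pr₁`. [folklore] -/
theorem proj_tubeInverse (p : ↥e.target) : (tubeInverse e p).proj = p.1.1 := by
  have h : e (e.symm p.1) = p.1 := e.right_inv p.2
  rw [he] at h
  exact (congrArg Prod.fst h)

omit [T2Space M] [CompactSpace M] in
include he in
/-- `ex ∘ Ψ = pr₂`. [folklore] -/
theorem ex_tubeInverse (p : ↥e.target) : ex (tubeInverse e p) = p.1.2 := by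
  have h : e (e.symm p.1) = p.1 := e.right_inv p.2
  rw [he] at h
  exact (congrArg Prod.snd h)

omit [T2Space M] [CompactSpace M] in
include he in
/-- `π ∘ Ψ = pr₁ ∘ incl` as continuous maps. [folklore] -/
theorem tangentProj_comp_tubeInverse :
    (tangentProj : C(TangentBundle (𝓡 4) M, M)).comp (tubeInverse e) =
      (ContinuousMap.fst : C(M × M, M)).comp (subsetIncl e.target) :=
  ContinuousMap.ext fun p ↦ proj_tubeInverse ex e he p

omit [T2Space M] [CompactSpace M] in
include he in
/-- `ex ∘ Ψ = pr₂ ∘ incl` as continuous maps. [folklore] -/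
theorem ex_comp_tubeInverse :
    ex.comp (tubeInverse e) = (ContinuousMap.snd : C(M × M, M)).comp (subsetIncl e.target) :=
  ContinuousMap.ext fun p ↦ ex_tubeInverse ex e he p

omit [T2Space M] [CompactSpace M] in
include he hez in
/-- **`Ψ` is a map of pairs `(N, N ∖ Δ) → (TM, TM ∖ 0)`**: off the diagonal the vector is non-zero.
[cite: MilnorStasheff1974, §11 Thm. 11.1] -/
theorem mapsTo_tubeInverse :
    MapsTo (tubeInverse e) (Subtype.val ⁻¹' {p : M × M | p.1 ≠ p.2}) {v : TangentBundle (𝓡 4) M | v.snd ≠ 0} := by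
  intro p hp h0
  have h1 : ex (tubeInverse e p) = (tubeInverse e p).proj := ((hez _ (e.map_target p.2)).2 h0)
  rw [ex_tubeInverse ex e he, proj_tubeInverse ex e he] at h1
  exact hp h1.symm

/-- **`u'|_N = Ψ^* τ ∈ H⁴(N, N ∖ Δ; ℤ/2)`**, the diagonal class read on the tube. [cite: MilnorStasheff1974, §11 p. 122] -/
def tubeClass : relSingularCohomology (ZMod 2) (ZMod 2) ↥e.target (Subtype.val ⁻¹' {p : M × M | p.1 ≠ p.2}) 4 :=
  relSingularCohomology.map (ZMod 2) (ZMod 2) (tubeInverse e) (mapsTo_tubeInverse ex e he hez) 4 J.tau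

omit [CompactSpace M] [ChartedSpace (EuclideanSpace ℝ (Fin 4)) M] [IsManifold (𝓡 4) ∞ M] J in
/-- The complement of the diagonal is open. [folklore] -/
theorem isOpen_offDiagonal : IsOpen {p : M × M | p.1 ≠ p.2} :=
  isClosed_diagonal.isOpen_compl

omit [T2Space M] [CompactSpace M] in
include he hez in
/-- The diagonal lies in the tube when the zero section lies in the source. [folklore] -/
theorem mem_target_of_zero (he0 : ∀ x : M, (⟨x, 0⟩ : TangentBundle (𝓡 4) M) ∈ e.source) (x : M) :
    (x, x) ∈ e.target := by
  have h := e.map_source (he0 x)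
  rw [he] at h
  have h2 : ex ⟨x, 0⟩ = x := (hez _ (he0 x)).2 rfl
  rwa [h2] at h

omit [CompactSpace M] in
/-- **Excision**: `H^m(M × M, M × M ∖ Δ) → H^m(N, N ∖ Δ)` is an isomorphism for an open `N ⊇ Δ`.
[cite: HatcherAT2002, §3.1 p. 201] -/
theorem isIso_excision_tube (hΔ : ∀ x : M, (x, x) ∈ e.target) (m : ℕ) :
    IsIso (relSingularCohomology.map (ZMod 2) (ZMod 2) (subsetIncl e.target)
      (mapsTo_preimage Subtype.val {p : M × M | p.1 ≠ p.2}) m) := by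
  refine relSingularCohomology.isIso_map_subsetIncl_of_interior (ZMod 2) (ZMod 2) {p : M × M | p.1 ≠ p.2} e.target ?_ m
  rw [isOpen_offDiagonal.interior_eq, e.open_target.interior_eq]
  refine eq_univ_of_forall fun p ↦ ?_
  by_cases hp : p.1 = p.2
  · right
    obtain ⟨a, b⟩ := p
    change a = b at hp
    subst hp
    exact hΔ a
  · exact Or.inl hp

variable (hΔ : ∀ x : M, (x, x) ∈ e.target)

/-- **The diagonal class `u' ∈ H⁴(M × M, M × M ∖ Δ; ℤ/2)`**: the tube class moved through the excision
isomorphism. [cite: MilnorStasheff1974, §11 p. 122] -/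
def diagRelClass : relSingularCohomology (ZMod 2) (ZMod 2) (M × M) {p : M × M | p.1 ≠ p.2} 4 :=
  haveI := isIso_excision_tube e hΔ 4
  inv (relSingularCohomology.map (ZMod 2) (ZMod 2) (subsetIncl e.target)
    (mapsTo_preimage Subtype.val {p : M × M | p.1 ≠ p.2}) 4) (J.tubeClass ex e he hez)

/-- **The diagonal class `u'' ∈ H⁴(M × M; ℤ/2)`**, image of `u'`. [cite: MilnorStasheff1974, §11 p. 125] -/
def diagClass : singularCohomology (ZMod 2) (ZMod 2) (M × M) 4 :=
  relSingularCohomology.toAbsolute (ZMod 2) (ZMod 2) (M × M) {p : M × M | p.1 ≠ p.2} 4 (J.diagRelClass ex e he hez hΔ)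

/-- `u'` restricts to the tube class. [folklore] -/
theorem map_subsetIncl_diagRelClass :
    relSingularCohomology.map (ZMod 2) (ZMod 2) (subsetIncl e.target)
      (mapsTo_preimage Subtype.val {p : M × M | p.1 ≠ p.2}) 4 (J.diagRelClass ex e he hez hΔ) =
        J.tubeClass ex e he hez := by
  haveI := isIso_excision_tube e hΔ 4
  exact IsIso.inv_hom_id_apply _ _

/-- **`Sq² u' = u' ⌣ (c̄₁ × 1)` in `H⁶(M × M, M × M ∖ Δ; ℤ/2)`** (Milnor–Stasheff, proof of Thm. 11.14:
`Sqᵏ u' = (wₖ × 1) ⌣ u'` through the tube and excision; here `k = 2`, `w₂ ≡ c₁ (TM, J)`).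
[cite: MilnorStasheff1974, §11 proof of Thm. 11.14 (p. 132)] -/
theorem relSteenrodSq_two_diagRelClass :
    relSteenrodSqLower (M × M) 4 {p : M × M | p.1 ≠ p.2} 6 2 (J.diagRelClass ex e he hez hΔ) =
      relSingularCohomology.cupRight (p := 4) (q := 2) (n := 6) rfl (J.diagRelClass ex e he hez hΔ)
        (singularCohomology.map (ZMod 2) (ZMod 2) (ContinuousMap.fst : C(M × M, M)) 2 J.cbarOne) := by
  haveI := isIso_excision_tube e hΔ 6
  refine (ConcreteCategory.bijective_of_isIso (relSingularCohomology.map (ZMod 2) (ZMod 2) (subsetIncl e.target)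
      (mapsTo_preimage Subtype.val {p : M × M | p.1 ≠ p.2}) 6)).1 ?_
  rw [relSteenrodSqLower_map, relSingularCohomology.map_cupRight, J.map_subsetIncl_diagRelClass, tubeClass,
    ← relSteenrodSqLower_map, J.relSteenrodSq_two_tau, relSingularCohomology.map_cupRight,
    ← ModuleCat.comp_apply, ← singularCohomology.map_comp, tangentProj_comp_tubeInverse ex e he,
    ← ModuleCat.comp_apply, ← singularCohomology.map_comp]

/-- **Lemma 11.8: `u' ⌣ (a × 1) = u' ⌣ (1 × a)`** for every `a ∈ Hᵏ(M; ℤ/2)` (both pull back, on the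
tube, to `τ ⌣ π^* a = τ ⌣ ex^* a`, and `π ≃ ex`). [cite: MilnorStasheff1974, §11 Lemma 11.8] -/
theorem cupRight_diagRelClass_fst_eq_snd (hex : (tangentProj : C(TangentBundle (𝓡 4) M, M)).Homotopic ex)
    {k m : ℕ} (h : 4 + k = m) (a : singularCohomology (ZMod 2) (ZMod 2) M k) :
    relSingularCohomology.cupRight h (J.diagRelClass ex e he hez hΔ)
        (singularCohomology.map (ZMod 2) (ZMod 2) (ContinuousMap.fst : C(M × M, M)) k a) =
      relSingularCohomology.cupRight h (J.diagRelClass ex e he hez hΔ)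
        (singularCohomology.map (ZMod 2) (ZMod 2) (ContinuousMap.snd : C(M × M, M)) k a) := by
  haveI := isIso_excision_tube e hΔ m
  refine (ConcreteCategory.bijective_of_isIso (relSingularCohomology.map (ZMod 2) (ZMod 2) (subsetIncl e.target)
      (mapsTo_preimage Subtype.val {p : M × M | p.1 ≠ p.2}) m)).1 ?_
  rw [relSingularCohomology.map_cupRight, relSingularCohomology.map_cupRight, J.map_subsetIncl_diagRelClass,
    ← ModuleCat.comp_apply, ← singularCohomology.map_comp, ← tangentProj_comp_tubeInverse ex e he,
    ← ModuleCat.comp_apply, ← singularCohomology.map_comp, ← ex_comp_tubeInverse ex e he,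
    singularCohomology.map_comp, singularCohomology.map_comp, ModuleCat.comp_apply, ModuleCat.comp_apply,
    singularCohomology.map_eq_of_homotopic_holds (ZMod 2) (ZMod 2) hex k]

/-- **`Sq² u'' = u'' ⌣ (c̄₁ × 1)` in `H⁶(M × M; ℤ/2)`.** [cite: MilnorStasheff1974, §11 proof of Thm. 11.14 (p. 132)] -/
theorem steenrodSq_two_diagClass :
    steenrodSq (M × M) 4 2 (J.diagClass ex e he hez hΔ) =
      cupProduct (p := 4) (q := 2) (n := 6) rfl (J.diagClass ex e he hez hΔ)
        (singularCohomology.map (ZMod 2) (ZMod 2) (ContinuousMap.fst : C(M × M, M)) 2 J.cbarOne) := by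
  show steenrodSqLower (M × M) 4 6 2 (J.diagClass ex e he hez hΔ) = _
  rw [diagClass, ← toAbsolute_relSteenrodSqLower, J.relSteenrodSq_two_diagRelClass,
    relSingularCohomology.toAbsolute_cupRight]

/-- **`u'' ⌣ (a × 1) = u'' ⌣ (1 × a)` in `H^*(M × M; ℤ/2)`.** [cite: MilnorStasheff1974, §11 Lemma 11.8] -/
theorem diagClass_cup_fst_eq_snd (hex : (tangentProj : C(TangentBundle (𝓡 4) M, M)).Homotopic ex)
    {k m : ℕ} (h : 4 + k = m) (a : singularCohomology (ZMod 2) (ZMod 2) M k) :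
    cupProduct h (J.diagClass ex e he hez hΔ) (singularCohomology.map (ZMod 2) (ZMod 2) (ContinuousMap.fst : C(M × M, M)) k a) =
      cupProduct h (J.diagClass ex e he hez hΔ) (singularCohomology.map (ZMod 2) (ZMod 2) (ContinuousMap.snd : C(M × M, M)) k a) := by
  rw [diagClass, ← relSingularCohomology.toAbsolute_cupRight, ← relSingularCohomology.toAbsolute_cupRight,
    J.cupRight_diagRelClass_fst_eq_snd ex e he hez hΔ hex h a]

end Tube

/-! ### The exponential tube -/

/-- **The exponential tube of a Riemannian metric has all the required properties**: on the closed
manifold `M` there are a continuous `ex : TM → M` homotopic to `π` and an open partial homeomorphism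
`e : TM ⇀ M × M`, `e v = (π v, ex v)`, with the zero section inside its source, on which
`ex v = π v ↔ v = 0` (`Riemannian.exists_expPair_openPartialHomeomorph`, `homotopic_proj_expMap` for a
smooth Riemannian metric, `Riemannian.PseudoRiemannianMetric.exists_isRiemannian`).
[cite: MilnorStasheff1974, §11 Thm. 11.1] -/
theorem exists_expTube [Nonempty M] :
    ∃ (ex : C(TangentBundle (𝓡 4) M, M)) (e : OpenPartialHomeomorph (TangentBundle (𝓡 4) M) (M × M)),
      (tangentProj : C(TangentBundle (𝓡 4) M, M)).Homotopic ex ∧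
      (∀ v, e v = (v.proj, ex v)) ∧ (∀ x : M, (⟨x, 0⟩ : TangentBundle (𝓡 4) M) ∈ e.source) ∧
      (∀ v ∈ e.source, ex v = v.proj ↔ v.snd = 0) := by
  obtain ⟨g, hg⟩ := Riemannian.exists_isRiemannian (I := 𝓡 4) (E := EuclideanSpace ℝ (Fin 4)) (M := M)
  haveI : Fact ((1 : ℕ∞ω) ≤ ∞) := ⟨by exact_mod_cast le_top⟩
  haveI := g.hasLeviCivita
  haveI : CovariantDerivative.ContMDiffCovariantDerivative g.leviCivita 1 :=
    ⟨g.isLocallyContMDiff_leviCivita_holds 1 (by exact_mod_cast le_top) univ isOpen_univ⟩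
  obtain ⟨e, he, he0, hez, -⟩ := Riemannian.exists_expPair_openPartialHomeomorph g le_rfl hg
  exact ⟨⟨fun v ↦ Riemannian.expMap g.leviCivita v.proj v.snd,
      Riemannian.continuous_expMap_totalSpace_of_compactSpace g le_rfl hg⟩, e,
    Riemannian.homotopic_proj_expMap g le_rfl hg, he, he0, hez⟩

end AlmostComplexStructure

end Literature.Geometry.Symplectic
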